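import Literature.NumberTheory.LFunctions.RodgersTaoAsymptotics
import HarnessLib

/-!
# Rodgers–Tao 2020, proof of Lemma 2.1: the real part of the phase in regime (iii) (huge `n`)
— node R3 of the R19 reduction (`rodgersTao_H_eq_half_Q_one`), exponent lemma

RH-FREE CONTENT (no definitions, no named facts). Trunk T-ANT (`Literature/NumberTheory/LFunctions`).
DRAFT by rt-iso g5 (R19 reviewer, rt-lead rulings (45)/(46)/(48)(c)): the «crude bound for huge
`b`» step of the proof of Lemma 2.1 of B. Rodgers, T. Tao, *The de Bruijn–Newman constant is
non-negative*, Forum Math. Pi 8 (2020) e6 = arXiv:1801.05914v5, §2 (FMP pp. 17–19), in the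
`T₀`-UNIFORM form needed by the typed target (rt/ERRATA E12, rt-t6 g3's finding, rt/STATUS
2026-08-26T09:58:33Z): the printed chain «`Σ_{n huge} Q_{t,n} ≪ exp(−100x/|t|) = O(|Q_{t,1}|/x)`»
silently uses `|t| = O(1)`; for `t ∈ [−T₀, 0)` with `T₀` arbitrary the factor `e^{−πx/8}` of the main
term must be recovered from the IMAGINARY PART of the saddle-point equation (23).

> Rodgers–Tao, FMP p. 12, eq. (23): `4b e^{4w₀} = ζ + 2t w₀`, `w₀ = α + iβ` in the strip
> `0 ≤ β < π/8` (21); Lemma 2.3 (iii) (FMP Lemma 6): «(Crude bound for huge `b`) If `ζ = y + ix` and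
> `b > x exp(x^{1/2}/|t|)`, then `Re w₀` is negative; in fact `−Re w₀ ≥ ⅛ log₊ b`»; p. 17: the phase
> `Re(tw₀² − be^{4w₀} + ζw₀) = Re(tw₀² − ζ/4 − tw₀/2 + ζw₀)`.

## Main result

`Literature.NumberTheory.LFunctions.rodgersTao_re_phase_le_regimeThree`: for `t ∈ [−T₀, 0)`, `b ≥ 1`,
`ζ = Y + ix` with `Y ≥ 0`, `x ≥ T₀π/2 + 1`, and a solution `w₀ = α + iβ` of (23) in the strip (21)
with `−α ≥ log₊ b/8` (the conclusion of Lemma 2.3 (iii)),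
`Re(tw₀² − be^{4w₀} + ζw₀) ≤ −πx/8 + (T₀π²/64 + T₀/16) + Y/4 − Y·log₊ b/8`.
Route: the imaginary/real parts of (23) read `4be^{4α} sin 4β = x + 2tβ`, `4be^{4α} cos 4β = Y + 2tα`,
so `β > 0`, and `π/2 − 4β ≤ tan(π/2 − 4β) = cot 4β = (Y + 2tα)/(x + 2tβ)`, whence
`x(π/8 − β) ≤ (Y + 2tα)/2` for `x ≥ T₀π/2`; the remaining terms are `−|t|α² + |t||α|/2 ≤ |t|/16`,
`|t|β² ≤ T₀π²/64`, `Yα ≤ −Y log₊ b/8`.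

bears_on: N-C/N-P (COLUMN 3 DBN). WHAT THIS IS NOT: an exponent estimate inside RT's RH-free
asymptotic for `H_t`, `t < 0`; nothing here bears on the truth of RH.
-/

noncomputable section

open Complex Filter Set Topology Real

namespace Literature.NumberTheory.LFunctions

/-- Real and imaginary parts of the saddle-point equation (23): `4b e^{4α} cos 4β = Re ζ + 2t α`
and `4b e^{4α} sin 4β = Im ζ + 2t β` for `w₀ = α + iβ`, real `b`, real `t`.
[cite: RodgersTaoFMP2020, §2 eq. (23) (FMP p. 12)] -/
theorem rodgersTao_saddleEq_re_im {t b : ℝ} {ζ w₀ : ℂ} (h : rodgersTaoSaddleEq t b ζ w₀) :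
    4 * b * Real.exp (4 * w₀.re) * Real.cos (4 * w₀.im) = ζ.re + 2 * t * w₀.re ∧
      4 * b * Real.exp (4 * w₀.re) * Real.sin (4 * w₀.im) = ζ.im + 2 * t * w₀.im := by
  unfold rodgersTaoSaddleEq at h
  have hre := congrArg Complex.re h
  have him := congrArg Complex.im h
  have e4re : (4 * w₀).re = 4 * w₀.re := by simp
  have e4im : (4 * w₀).im = 4 * w₀.im := by simp
  simp only [Complex.mul_re, Complex.mul_im, Complex.exp_re, Complex.exp_im, e4re, e4im,
    Complex.ofReal_re, Complex.ofReal_im, Complex.add_re, Complex.add_im,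
    Complex.re_ofNat, Complex.im_ofNat, mul_zero, sub_zero, zero_mul, add_zero] at hre him
  constructor
  · rw [← hre]; ring
  · rw [← him]; ring

/-- **The imaginary part of (23) pins `β` to `π/8`**: for `ζ = Y + ix` with `x > −2tβ` (e.g.
`x ≥ T₀π/4 + 1`, and `x ≥ 0`), a strip solution `w₀ = α + iβ` of (23) has `0 < 4β < π/2` and
`x(π/8 − β) ≤ (x/4)·(Y + 2tα)/(x + 2tβ)` (`u ≤ tan u` at `u = π/2 − 4β`, `cot 4β` from (23)).
[cite: RodgersTaoFMP2020, §2 eq. (23) (FMP p. 12)] -/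
theorem rodgersTao_pi_div_eight_sub_im_le {t b : ℝ} {ζ w₀ : ℂ} (hb : 0 < b)
    (hw : w₀ ∈ rodgersTaoStrip) (h : rodgersTaoSaddleEq t b ζ w₀) (hx0 : 0 ≤ ζ.im)
    (hx : 0 < ζ.im + 2 * t * w₀.im) :
    0 < w₀.im ∧
      ζ.im * (π / 8 - w₀.im) ≤ ζ.im / 4 * ((ζ.re + 2 * t * w₀.re) / (ζ.im + 2 * t * w₀.im)) := by
  obtain ⟨hre, him⟩ := rodgersTao_saddleEq_re_im h
  obtain ⟨hβ0, hβlt⟩ := mem_rodgersTaoStrip.1 hw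
  have hE : 0 < 4 * b * Real.exp (4 * w₀.re) := by positivity
  -- `β > 0`: otherwise `sin 4β = 0` and `x + 2tβ = 0`
  have hβpos : 0 < w₀.im := by
    rcases eq_or_lt_of_le hβ0 with h0 | h0
    · exfalso
      rw [← h0, mul_zero, Real.sin_zero, mul_zero] at him
      rw [← h0] at hx
      linarith
    · exact h0
  refine ⟨hβpos, ?_⟩
  have h4β0 : 0 < 4 * w₀.im := by linarith
  have h4βlt : 4 * w₀.im < π / 2 := by linarith
  have hsin : 0 < Real.sin (4 * w₀.im) := Real.sin_pos_of_pos_of_lt_pi h4β0 (by linarith [Real.pi_pos])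
  have hcos : 0 < Real.cos (4 * w₀.im) :=
    Real.cos_pos_of_mem_Ioo ⟨by linarith [Real.pi_pos], h4βlt⟩
  -- `cot 4β = (Y + 2tα)/(x + 2tβ)`
  have hcot : Real.cos (4 * w₀.im) / Real.sin (4 * w₀.im) =
      (ζ.re + 2 * t * w₀.re) / (ζ.im + 2 * t * w₀.im) := by
    rw [div_eq_div_iff hsin.ne' hx.ne']
    have e1 : Real.cos (4 * w₀.im) * (ζ.im + 2 * t * w₀.im) =
        Real.cos (4 * w₀.im) * (4 * b * Real.exp (4 * w₀.re) * Real.sin (4 * w₀.im)) := by rw [him]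
    have e2 : (ζ.re + 2 * t * w₀.re) * Real.sin (4 * w₀.im) =
        (4 * b * Real.exp (4 * w₀.re) * Real.cos (4 * w₀.im)) * Real.sin (4 * w₀.im) := by rw [hre]
    rw [e1, e2]; ring
  -- `u ≤ tan u` for `u = π/2 − 4β ∈ [0, π/2)`
  have hu0 : 0 ≤ π / 2 - 4 * w₀.im := by linarith
  have hult : π / 2 - 4 * w₀.im < π / 2 := by linarith
  have htan := Real.le_tan hu0 hult
  rw [Real.tan_pi_div_two_sub, Real.tan_eq_sin_div_cos, inv_div, hcot] at htan
  -- `x(π/8 − β) = (x/4)(π/2 − 4β)`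
  have hx0' : 0 ≤ ζ.im / 4 := by linarith
  calc ζ.im * (π / 8 - w₀.im) = ζ.im / 4 * (π / 2 - 4 * w₀.im) := by ring
    _ ≤ ζ.im / 4 * ((ζ.re + 2 * t * w₀.re) / (ζ.im + 2 * t * w₀.im)) :=
        mul_le_mul_of_nonneg_left htan hx0'

/-- **Regime (iii) real-part bound, `T₀`-uniform** (the «crude bound for huge `b`» step of the
proof of Lemma 2.1, made uniform in `t ∈ [−T₀, 0)` via the imaginary part of (23)): for `b ≥ 1`,
`ζ = Y + ix` with `Y ≥ 0` and `x ≥ T₀π/2 + 1`, and a strip solution `w₀` of (23) with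
`−Re w₀ ≥ log₊ b/8` (Lemma 2.3 (iii)),
`Re(tw₀² − be^{4w₀} + ζw₀) ≤ −πx/8 + (T₀π²/64 + T₀/16) + Y/4 − Y log₊ b/8`.
[cite: RodgersTaoFMP2020, §2 proof of Lemma 2.1 (FMP pp. 17–19), with Lemma 2.3 (iii) and eq. (23)] -/
theorem rodgersTao_re_phase_le_regimeThree (T₀ : ℝ) {t b : ℝ} (ht : t ∈ Ico (-T₀) 0) (hb : 1 ≤ b)
    {ζ w₀ : ℂ} (hY : 0 ≤ ζ.re) (hx : T₀ * π / 2 + 1 ≤ ζ.im) (hw : w₀ ∈ rodgersTaoStrip)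
    (h : rodgersTaoSaddleEq t b ζ w₀) (hα : logPlus b / 8 ≤ -w₀.re) :
    (t * w₀ ^ 2 - (b : ℂ) * Complex.exp (4 * w₀) + ζ * w₀).re ≤
      -(π * ζ.im / 8) + (T₀ * π ^ 2 / 64 + T₀ / 16) + ζ.re / 4 - ζ.re * logPlus b / 8 := by
  obtain ⟨ht1, ht2⟩ := ht
  have hπ := Real.pi_pos
  have htabs : |t| ≤ T₀ := by rw [abs_of_neg ht2]; linarith
  have hT₀ : 0 ≤ T₀ := (abs_nonneg t).trans htabs
  obtain ⟨hβ0, hβlt⟩ := mem_rodgersTaoStrip.1 hw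
  set α : ℝ := w₀.re with hαdef
  set β : ℝ := w₀.im with hβdef
  set x : ℝ := ζ.im with hxdef
  set Y : ℝ := ζ.re with hYdef
  -- sizes
  have htβ : -(T₀ * π / 4) ≤ 2 * t * β := by
    have h1 : -T₀ * β ≤ t * β := mul_le_mul_of_nonneg_right ht1 hβ0
    have h2 : T₀ * β ≤ T₀ * (π / 8) := mul_le_mul_of_nonneg_left hβlt.le hT₀
    linarith
  have hxtβ : 0 < x + 2 * t * β := by nlinarith
  have hx0 : 0 < x := by nlinarith
  -- the phase in real coordinates (from (23): `Re(b e^{4w₀}) = (Y + 2tα)/4`)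
  obtain ⟨hre, him⟩ := rodgersTao_saddleEq_re_im h
  have hbexp : ((b : ℂ) * Complex.exp (4 * w₀)).re = (Y + 2 * t * α) / 4 := by
    have e : ((b : ℂ) * Complex.exp (4 * w₀)).re = b * Real.exp (4 * α) * Real.cos (4 * β) := by
      have e4re : (4 * w₀).re = 4 * α := by simp [hαdef]
      have e4im : (4 * w₀).im = 4 * β := by simp [hβdef]
      rw [Complex.mul_re, Complex.exp_re, Complex.exp_im, e4re, e4im, Complex.ofReal_re,
        Complex.ofReal_im, zero_mul, sub_zero, mul_assoc]
    rw [e]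
    linarith
  have hphase : (t * w₀ ^ 2 - (b : ℂ) * Complex.exp (4 * w₀) + ζ * w₀).re =
      t * (α ^ 2 - β ^ 2) - (Y + 2 * t * α) / 4 + Y * α - x * β := by
    rw [Complex.add_re, Complex.sub_re, hbexp]
    simp only [Complex.mul_re, Complex.mul_im, sq, Complex.ofReal_re, Complex.ofReal_im, hαdef, hβdef,
      hxdef, hYdef]
    ring
  rw [hphase]
  -- `x(π/8 − β) ≤ (Y + 2tα)/2`
  obtain ⟨hβpos, hkey⟩ := rodgersTao_pi_div_eight_sub_im_le (by linarith) hw h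
    (by rw [← hxdef]; exact hx0.le) (by rw [← hxdef, ← hβdef]; exact hxtβ)
  rw [← hxdef, ← hβdef, ← hYdef, ← hαdef] at hkey
  have hnum : 0 ≤ Y + 2 * t * α := by
    rw [← hre]
    have hcos : 0 ≤ Real.cos (4 * β) :=
      (Real.cos_pos_of_mem_Ioo ⟨by linarith, by linarith⟩).le
    positivity
  have hxβ : x * (π / 8 - β) ≤ (Y + 2 * t * α) / 2 := by
    have h1 : x / 4 * ((Y + 2 * t * α) / (x + 2 * t * β)) ≤ (Y + 2 * t * α) / 2 := by
      rw [div_mul_eq_mul_div, div_le_iff₀ (by norm_num : (0 : ℝ) < 4)]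
      have h2 : (Y + 2 * t * α) / (x + 2 * t * β) ≤ (Y + 2 * t * α) / (x / 2) := by
        apply div_le_div_of_nonneg_left hnum (by positivity)
        linarith
      have h3 : x * ((Y + 2 * t * α) / (x / 2)) = 2 * (Y + 2 * t * α) := by
        field_simp
      nlinarith [mul_le_mul_of_nonneg_left h2 hx0.le]
    exact hkey.trans h1
  -- the remaining elementary terms
  have h1 : t * α ^ 2 + t * α / 2 ≤ T₀ / 16 := by
    -- `tα² + tα/2 = −|t|(α² − |α|/2)`… with `t ≤ 0`: `t(α² + α/2) = t((α + 1/4)² − 1/16) ≤ −t/16 ≤ T₀/16`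
    have e : t * α ^ 2 + t * α / 2 = t * (α + 1 / 4) ^ 2 - t / 16 := by ring
    rw [e]
    have : t * (α + 1 / 4) ^ 2 ≤ 0 := mul_nonpos_of_nonpos_of_nonneg ht2.le (sq_nonneg _)
    linarith
  have h2 : -(t * β ^ 2) ≤ T₀ * π ^ 2 / 64 := by
    have hβ2 : β ^ 2 ≤ (π / 8) ^ 2 := pow_le_pow_left₀ hβ0 hβlt.le 2
    have : -t ≤ T₀ := by linarith
    nlinarith [sq_nonneg β]
  have h3 : Y * α ≤ -(Y * logPlus b / 8) := by
    have : Y * α ≤ Y * (-(logPlus b / 8)) := mul_le_mul_of_nonneg_left (by linarith) hY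
    linarith
  nlinarith [hxβ, h1, h2, h3]

end Literature.NumberTheory.LFunctions

end
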